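/-
Copyright (c) 2026 the pub-hodgecm-mathlib formalisation cell (harness21).  Prover seat hodgecm-mathlib-LH6-p04 (g11), 2026-09-03.  E1 item (U7) «GEODESIC INCLUSION»
(E1 keeper ∕ dealer F0P3a-p03 (g29) 01:19:21Z, census `F0/P3b/LH6-p04/g11/u7/CENSUS-U7-geodesic-inclusion.v0.LH6p04g11.md`), FILE α «WEIGHTED GAUSS».
-/
import Mathlib.LinearAlgebra.Matrix.Block
import Literature.NumberTheory.Automorphic.UnitaryLatticeTreeLevelGroups     -- ★ row 22: the level token `M.map (toLin' (g − 1)) ≤ scaleLattice c M`, `mem_scaleLattice_iff`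
import Literature.NumberTheory.Automorphic.UnitaryLatticeTreeSelfDualFrames   -- ★ `mem_latt_diagonal_iff` (membership in `latt (diagonal d)`)
import HarnessLib

/-!
# The lattice graph of a hermitian space — WEIGHTED GAUSS (LDU) FACTORISATION AT LEVEL `c` ON A DIAGONAL LATTICE `latt (diagonal d)`, and the MONOTONE TRANSFER
# of the triangular factors between diagonal lattices (the lattice-model form of the Iwahori factorisation of the Schneider–Stuhler level groups, [SS97] I.2.7)

Topic `NumberTheory/Automorphic`; namespace `Literature.NumberTheory.Automorphic.UnitaryLatticeTree` (T1a currency of ★ `UnitaryLatticeTreeDefs`: `[Valued K ℤᵐ⁰]`, lattices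
`latt A = A·𝒪^N`, `scaleLattice c M = c·M`).  THEOREMS ONLY (no definition, no instance, no notation, no named fact, no `sorry`); kernel lane.  Cell `pub/hodgecm-mathlib`
(D-0151), crux H413 = `stmt-HodgeConjecture-24833`; E1 item (U7) of the E1 BRICK LEDGER (keeper F0P3a-p03 (g29)), file α of four (α weighted Gauss, β unitary Gauss = (U7) on the
standard apartment, γ geodesics lie in apartments, δ the HEAD `U_y ⊆ U_x · U_z` in row 34's letters).  HONEST LABEL: count-neutral generic base layer of the (R-SS) resolution
engine (census E1 v1 §1–§2); (R-SS) is NOT chartered; HC_CM is proved only modulo the 2 remaining named inputs (hLiu418 24832, h413 24833) until rung 0 closes; nothing printed is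
asserted here — this is Gauss elimination over a valued field.

THE MATHEMATICS.  `K` a field with a valuation `v` into `ℤᵐ⁰`, `d : Fin N → K` with `d_i ≠ 0`, `M = latt (diagonal d) = ⊕ d_i 𝒪 e_i`, `c ∈ K`.
* §1 THE LEVEL TOKEN ON A DIAGONAL LATTICE IS ENTRYWISE: `(A·M ⊆ c·M) ↔ ∀ i j, |A_{ij}|·|d_j| ≤ |c|·|d_i|` («`v(A_{ij}) ≥ v(c) + v(d_i) − v(d_j)`»; applied with `A = g − 1` this is
  row 22's token `LEV(M, c, g)`).  We call the right-hand side the WEIGHTED BOUND of `A` for `(d, c)`.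
* §2 CONJUGATION BY `diagonal d`: `A ↦ (d_i A_{ij} d_j⁻¹)` turns the plain bound `|A′_{ij}| ≤ |c|` into the weighted bound and respects products, triangular shapes and diagonals.
* §3 PLAIN GAUSS at `N = 3`: if `|g_{ij} − δ_{ij}| ≤ |c| < 1` for all `i, j`, then `g = L·D·U` with `L` lower unitriangular, `D` diagonal, `U` upper unitriangular, each satisfying the
  same plain bound (explicit `3 × 3` formulas; the pivots are `1`-units).
* §4 WEIGHTED GAUSS at `N = 3`: the same with the weighted bound for `(d, c)` throughout (conjugate §3 by `diagonal d`).
* §5 MONOTONE TRANSFER (any `N`): a LOWER triangular `A` with the weighted bound for `(d, c)` has it for `(d′, c)` whenever `|d′_j|·|d_i| ≤ |d_j|·|d′_i|` for all `j ≤ i`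
  («the exponent difference `E′ − E` is non-increasing»); an UPPER triangular one whenever `|d′_j|·|d_i| ≤ |d_j|·|d′_i|` for all `i ≤ j`; a DIAGONAL one for every `d′`.
  Along the standard apartment of the `U(3)` tree (`E(2a) = (a,0,−a)`, `E(2a+1) = (a+1,0,−a)`, steps `(1,0,0)` and `(0,0,−1)`) this is exactly what makes
  `U_{A(j)} ⊆ U_{A(i)} · U_{A(k)}` for `i ≤ j ≤ k` (file β adds the unitarity of the factors).

## References
* [SchneiderStuhler1997] P. Schneider, U. Stuhler, *Representation theory and sheaves on the Bruhat–Tits building*, Publ. Math. IHÉS 85 (1997): Ch. I §2 Prop. I.2.7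
  (Iwahori factorisation of `U_F^{(e)}`), Prop. I.3.1 p. 118 (geodesic inclusion).
* [BruhatTits1972] F. Bruhat, J. Tits, *Groupes réductifs sur un corps local* I, Publ. Math. IHÉS 41 (1972): §10 (lattice model of the building of a classical group).
* [Serre1980Trees] J.-P. Serre, *Trees* (1980): Ch. II §1.1–1.2 (lattices, congruence level).
-/

set_option autoImplicit false

noncomputable section

open scoped Valued WithZero Matrix MatrixGroups

namespace Literature.NumberTheory.Automorphic.UnitaryLatticeTree

open Literature.NumberTheory.Automorphic Literature.NumberTheory.Automorphic.HermitianLattice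

variable {K : Type*} [Field K] [Valued K ℤᵐ⁰] {N : ℕ}

/-! ## §1 The level token on a diagonal lattice is an entrywise weighted bound -/

omit [Valued K ℤᵐ⁰] in
/-- `(A *ᵥ Pi.single j x) i = A i j * x`. [cite: Serre1980Trees, Ch. II §1.1] -/
theorem mulVec_single_apply' (A : Matrix (Fin N) (Fin N) K) (j : Fin N) (x : K) (i : Fin N) :
    (A *ᵥ Pi.single j x) i = A i j * x := by
  change (fun k => A i k) ⬝ᵥ Pi.single j x = A i j * x
  rw [dotProduct_single]

/-- `d_j e_j ∈ latt (diagonal d)`. [cite: Serre1980Trees, Ch. II §1.1] -/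
theorem single_mem_latt_diagonal {d : Fin N → K} (hd : ∀ i, d i ≠ 0) (j : Fin N) :
    (Pi.single j (d j) : Fin N → K) ∈ latt (Matrix.diagonal d) := by
  rw [mem_latt_diagonal_iff hd]
  intro k
  by_cases hk : k = j
  · subst hk; rw [Pi.single_eq_same]
  · rw [Pi.single_eq_of_ne hk, map_zero]; exact zero_le

/-- **THE LEVEL TOKEN ON A DIAGONAL LATTICE IS ENTRYWISE**: for `M = latt (diagonal d)` (`d_i ≠ 0`) and `c ≠ 0`,
`A·M ⊆ c·M ↔ ∀ i j, |A_{ij}|·|d_j| ≤ |c|·|d_i|`.  With `A = g − 1` the left-hand side is row 22's level token `LEV(M, c, g)`.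
[cite: SchneiderStuhler1997, Ch. I §2] [cite: Serre1980Trees, Ch. II §1.2] -/
theorem latt_diagonal_map_le_scaleLattice_iff {d : Fin N → K} (hd : ∀ i, d i ≠ 0) {c : K} (hc : c ≠ 0) (A : Matrix (Fin N) (Fin N) K) :
    (latt (Matrix.diagonal d)).map ((Matrix.toLin' A).restrictScalars 𝒪[K]) ≤ scaleLattice c (latt (Matrix.diagonal d)) ↔
      ∀ i j, Valued.v (A i j) * Valued.v (d j) ≤ Valued.v c * Valued.v (d i) := by
  have hvc : Valued.v c ≠ 0 := (Valuation.ne_zero_iff _).2 hc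
  constructor
  · intro h i j
    have h2 := h (Submodule.mem_map_of_mem (f := (Matrix.toLin' A).restrictScalars 𝒪[K]) (single_mem_latt_diagonal hd j))
    rw [LinearMap.restrictScalars_apply, Matrix.toLin'_apply, mem_scaleLattice_iff hc, mem_latt_diagonal_iff hd] at h2
    have h3 := h2 i
    rw [Pi.smul_apply, mulVec_single_apply', smul_eq_mul, map_mul, map_mul, map_inv₀] at h3
    have h4 := mul_le_mul_right h3 (Valued.v c)
    rwa [← mul_assoc, ← mul_assoc, mul_inv_cancel₀ hvc, one_mul] at h4
  · intro h
    rintro _ ⟨x, hx, rfl⟩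
    rw [LinearMap.restrictScalars_apply, Matrix.toLin'_apply, mem_scaleLattice_iff hc, mem_latt_diagonal_iff hd]
    rw [SetLike.mem_coe, mem_latt_diagonal_iff hd] at hx
    intro i
    rw [Pi.smul_apply, smul_eq_mul, map_mul, map_inv₀]
    -- `|c|⁻¹ · |Σ_j A_{ij} x_j| ≤ |d_i|`
    have hsum : Valued.v ((A *ᵥ x) i) ≤ Valued.v c * Valued.v (d i) := by
      change Valued.v (∑ j, A i j * x j) ≤ _
      refine Valuation.map_sum_le _ fun j _ => ?_
      rw [map_mul]
      exact (mul_le_mul_right (hx j) _).trans (h i j)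
    calc (Valued.v c)⁻¹ * Valued.v ((A *ᵥ x) i) ≤ (Valued.v c)⁻¹ * (Valued.v c * Valued.v (d i)) := mul_le_mul_right hsum _
      _ = Valued.v (d i) := by rw [← mul_assoc, inv_mul_cancel₀ hvc, one_mul]

/-! ## §2 Conjugation by `diagonal d`: plain bound ↔ weighted bound; products, shapes, diagonals -/

omit [Valued K ℤᵐ⁰] in
/-- Conjugation `A ↦ (d_i A_{ij} d_j⁻¹)` is multiplicative. [cite: Serre1980Trees, Ch. II §1.1] -/
theorem of_conjDiag_mul {d : Fin N → K} (hd : ∀ i, d i ≠ 0) (X Y : Matrix (Fin N) (Fin N) K) :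
    (Matrix.of fun i j => d i * X i j * (d j)⁻¹) * (Matrix.of fun i j => d i * Y i j * (d j)⁻¹) =
      Matrix.of fun i j => d i * (X * Y) i j * (d j)⁻¹ := by
  ext i j
  rw [Matrix.mul_apply, Matrix.of_apply, Matrix.mul_apply, Finset.mul_sum, Finset.sum_mul]
  refine Finset.sum_congr rfl fun k _ => ?_
  rw [Matrix.of_apply, Matrix.of_apply]
  have hk : (d k)⁻¹ * d k = 1 := inv_mul_cancel₀ (hd k)
  calc d i * X i k * (d k)⁻¹ * (d k * Y k j * (d j)⁻¹) = d i * X i k * ((d k)⁻¹ * d k) * Y k j * (d j)⁻¹ := by ring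
    _ = d i * (X i k * Y k j) * (d j)⁻¹ := by rw [hk]; ring

omit [Valued K ℤᵐ⁰] in
/-- Conjugating back: `d_i · (d_i⁻¹ A_{ij} d_j) · d_j⁻¹ = A_{ij}`. [cite: Serre1980Trees, Ch. II §1.1] -/
theorem of_conjDiag_conjDiagInv {d : Fin N → K} (hd : ∀ i, d i ≠ 0) (A : Matrix (Fin N) (Fin N) K) :
    (Matrix.of fun i j => d i * (Matrix.of fun i' j' => (d i')⁻¹ * A i' j' * d j') i j * (d j)⁻¹) = A := by
  ext i j
  simp only [Matrix.of_apply]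
  calc d i * ((d i)⁻¹ * A i j * d j) * (d j)⁻¹ = (d i * (d i)⁻¹) * A i j * (d j * (d j)⁻¹) := by ring
    _ = A i j := by rw [mul_inv_cancel₀ (hd i), mul_inv_cancel₀ (hd j), one_mul, mul_one]

omit [Valued K ℤᵐ⁰] in
/-- The conjugate of `1` is `1`. [cite: Serre1980Trees, Ch. II §1.1] -/
theorem of_conjDiag_one {d : Fin N → K} (hd : ∀ i, d i ≠ 0) :
    (Matrix.of fun i j => d i * (1 : Matrix (Fin N) (Fin N) K) i j * (d j)⁻¹) = 1 := by
  ext i j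
  rw [Matrix.of_apply]
  by_cases hij : i = j
  · subst hij; rw [Matrix.one_apply_eq, mul_one, mul_inv_cancel₀ (hd i)]
  · rw [Matrix.one_apply_ne hij, mul_zero, zero_mul]

omit [Valued K ℤᵐ⁰] in
/-- Conjugation commutes with `· − 1`. [cite: Serre1980Trees, Ch. II §1.1] -/
theorem of_conjDiag_sub_one {d : Fin N → K} (hd : ∀ i, d i ≠ 0) (X : Matrix (Fin N) (Fin N) K) :
    (Matrix.of fun i j => d i * X i j * (d j)⁻¹) - 1 = Matrix.of fun i j => d i * (X - 1) i j * (d j)⁻¹ := by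
  conv_lhs => rw [← of_conjDiag_one hd]
  ext i j
  simp only [Matrix.sub_apply, Matrix.of_apply]
  ring

/-- **PLAIN BOUND ↔ WEIGHTED BOUND under conjugation**: `|d_i A_{ij} d_j⁻¹| ≤ |c| ↔ |A_{ij}|·|d_j| ≤ |c|·|d_i|`... read for the matrix `(d_i A_{ij} d_j⁻¹)`:
its weighted bound for `(d, c)` is the plain bound of `A`. [cite: SchneiderStuhler1997, Ch. I §2] -/
theorem weighted_of_conjDiag_iff {d : Fin N → K} (hd : ∀ i, d i ≠ 0) (c : K) (A : Matrix (Fin N) (Fin N) K) (i j : Fin N) :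
    Valued.v ((Matrix.of fun i j => d i * A i j * (d j)⁻¹) i j) * Valued.v (d j) ≤ Valued.v c * Valued.v (d i) ↔ Valued.v (A i j) ≤ Valued.v c := by
  have hdi : Valued.v (d i) ≠ 0 := (Valuation.ne_zero_iff _).2 (hd i)
  have hdj : Valued.v (d j) ≠ 0 := (Valuation.ne_zero_iff _).2 (hd j)
  rw [Matrix.of_apply, map_mul, map_mul, map_inv₀, mul_assoc, inv_mul_cancel₀ hdj, mul_one, mul_comm (Valued.v (d i)) (Valued.v (A i j))]
  constructor
  · intro h; exact le_of_mul_le_mul_right h (zero_lt_iff.2 hdi)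
  · intro h; exact mul_le_mul_left h _

/-- The weighted bound of `A` for `(d, c)` is the plain bound of the conjugate `(d_i⁻¹ A_{ij} d_j)`. [cite: SchneiderStuhler1997, Ch. I §2] -/
theorem weighted_iff_plain_conjDiagInv {d : Fin N → K} (hd : ∀ i, d i ≠ 0) (c : K) (A : Matrix (Fin N) (Fin N) K) (i j : Fin N) :
    Valued.v (A i j) * Valued.v (d j) ≤ Valued.v c * Valued.v (d i) ↔ Valued.v ((Matrix.of fun i' j' => (d i')⁻¹ * A i' j' * d j') i j) ≤ Valued.v c := by
  rw [← weighted_of_conjDiag_iff hd c (Matrix.of fun i' j' => (d i')⁻¹ * A i' j' * d j') i j, of_conjDiag_conjDiagInv hd]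

omit [Valued K ℤᵐ⁰] in
/-- The inverse conjugate of `1` is `1`. [cite: Serre1980Trees, Ch. II §1.1] -/
theorem of_conjDiagInv_one {d : Fin N → K} (hd : ∀ i, d i ≠ 0) :
    (Matrix.of fun i j => (d i)⁻¹ * (1 : Matrix (Fin N) (Fin N) K) i j * d j) = 1 := by
  ext i j
  rw [Matrix.of_apply]
  by_cases hij : i = j
  · subst hij; rw [Matrix.one_apply_eq, mul_one, inv_mul_cancel₀ (hd i)]
  · rw [Matrix.one_apply_ne hij, mul_zero, zero_mul]

omit [Valued K ℤᵐ⁰] in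
/-- Inverse conjugation commutes with `· − 1`. [cite: Serre1980Trees, Ch. II §1.1] -/
theorem of_conjDiagInv_sub_one {d : Fin N → K} (hd : ∀ i, d i ≠ 0) (X : Matrix (Fin N) (Fin N) K) :
    (Matrix.of fun i j => (d i)⁻¹ * X i j * d j) - 1 = Matrix.of fun i j => (d i)⁻¹ * (X - 1) i j * d j := by
  conv_lhs => rw [← of_conjDiagInv_one hd]
  ext i j
  simp only [Matrix.sub_apply, Matrix.of_apply]
  ring

/-! ## §3 Plain Gauss at `N = 3`: `g = L·D·U` inside the congruence set `{|g − 1| ≤ |c|}`, `|c| < 1` -/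

/-- A `1`-unit has valuation `1`: `|x − 1| < 1 ⇒ |x| = 1`. [cite: Serre1980Trees, Ch. II §1.2] -/
theorem v_eq_one_of_v_sub_one_lt_one {x : K} (h : Valued.v (x - 1) < 1) : Valued.v x = 1 := by
  have h' : Valued.v (x - 1) < Valued.v (1 : K) := by rwa [Valuation.map_one]
  rw [Valuation.map_eq_of_sub_lt _ h', Valuation.map_one]

/-- `|x| ≤ t`, `|y| ≤ t`, `t ≤ 1` ⇒ `|x·y| ≤ t`. [cite: Serre1980Trees, Ch. II §1.2] -/
theorem v_mul_le_of_le_of_le_of_le_one {x y : K} {t : ℤᵐ⁰} (hx : Valued.v x ≤ t) (hy : Valued.v y ≤ t) (ht : t ≤ 1) : Valued.v (x * y) ≤ t := by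
  rw [map_mul]
  calc Valued.v x * Valued.v y ≤ t * 1 := mul_le_mul' hx (hy.trans ht)
    _ = t := mul_one t

omit [Valued K ℤᵐ⁰] in
/-- Entries of a `3 × 3` matrix minus `1`: the nine cases. [cite: Serre1980Trees, Ch. II §1.1] -/
theorem sub_one_apply_three (X : Matrix (Fin 3) (Fin 3) K) :
    (X - 1) 0 0 = X 0 0 - 1 ∧ (X - 1) 0 1 = X 0 1 ∧ (X - 1) 0 2 = X 0 2 ∧
    (X - 1) 1 0 = X 1 0 ∧ (X - 1) 1 1 = X 1 1 - 1 ∧ (X - 1) 1 2 = X 1 2 ∧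
    (X - 1) 2 0 = X 2 0 ∧ (X - 1) 2 1 = X 2 1 ∧ (X - 1) 2 2 = X 2 2 - 1 := by
  refine ⟨?_, ?_, ?_, ?_, ?_, ?_, ?_, ?_, ?_⟩ <;> simp [Matrix.sub_apply]

/-- Entrywise bound for a `3 × 3` matrix from its nine entries. [cite: Serre1980Trees, Ch. II §1.1] -/
theorem forall_v_apply_le_three {X : Matrix (Fin 3) (Fin 3) K} {t : ℤᵐ⁰}
    (h00 : Valued.v (X 0 0) ≤ t) (h01 : Valued.v (X 0 1) ≤ t) (h02 : Valued.v (X 0 2) ≤ t)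
    (h10 : Valued.v (X 1 0) ≤ t) (h11 : Valued.v (X 1 1) ≤ t) (h12 : Valued.v (X 1 2) ≤ t)
    (h20 : Valued.v (X 2 0) ≤ t) (h21 : Valued.v (X 2 1) ≤ t) (h22 : Valued.v (X 2 2) ≤ t) :
    ∀ i j, Valued.v (X i j) ≤ t := by
  intro i j
  fin_cases i <;> fin_cases j <;> assumption

/-- **PLAIN GAUSS AT `N = 3`**: if `|(g − 1)_{ij}| ≤ |c| < 1` for all `i, j`, then `g = L·D·U` with `L` lower unitriangular, `D` diagonal, `U` upper unitriangular, each congruent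
to `1` modulo `c` (the pivots `g₀₀`, `g₁₁ − g₁₀g₀₁/g₀₀`, … are `1`-units). [cite: SchneiderStuhler1997, Ch. I §2 Prop. I.2.7] [cite: Serre1980Trees, Ch. II §1.2] -/
theorem exists_plain_ldu_three {c : K} (hc1 : Valued.v c < 1) (g : Matrix (Fin 3) (Fin 3) K) (hg : ∀ i j, Valued.v ((g - 1) i j) ≤ Valued.v c) :
    ∃ L D U : Matrix (Fin 3) (Fin 3) K, g = L * D * U ∧
      L.BlockTriangular OrderDual.toDual ∧ (∀ i, L i i = 1) ∧ (∀ i j, i ≠ j → D i j = 0) ∧ U.BlockTriangular id ∧ (∀ i, U i i = 1) ∧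
      (∀ i j, Valued.v ((L - 1) i j) ≤ Valued.v c) ∧ (∀ i j, Valued.v ((D - 1) i j) ≤ Valued.v c) ∧ (∀ i j, Valued.v ((U - 1) i j) ≤ Valued.v c) := by
  obtain ⟨e00, e01, e02, e10, e11, e12, e20, e21, e22⟩ := sub_one_apply_three g
  have h00 := hg 0 0; have h01 := hg 0 1; have h02 := hg 0 2; have h10 := hg 1 0; have h11 := hg 1 1; have h12 := hg 1 2
  have h20 := hg 2 0; have h21 := hg 2 1; have h22 := hg 2 2
  rw [e00] at h00; rw [e01] at h01; rw [e02] at h02; rw [e10] at h10; rw [e11] at h11; rw [e12] at h12; rw [e20] at h20; rw [e21] at h21; rw [e22] at h22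
  have ht1 : Valued.v c ≤ 1 := hc1.le
  have hv0 : Valued.v (0 : K) ≤ Valued.v c := by rw [map_zero]; exact zero_le
  -- the first pivot
  have ha : Valued.v (g 0 0) = 1 := v_eq_one_of_v_sub_one_lt_one (h00.trans_lt hc1)
  have ha0 : g 0 0 ≠ 0 := fun h => by rw [h, map_zero] at ha; exact zero_ne_one ha
  have hdiv : ∀ x : K, Valued.v (x / g 0 0) = Valued.v x := fun x => by rw [map_div₀, ha, div_one]
  -- the second pivot
  have hd1 : Valued.v (g 1 1 - g 1 0 * g 0 1 / g 0 0 - 1) ≤ Valued.v c := by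
    rw [sub_right_comm]
    refine (Valuation.map_sub _ _ _).trans (max_le h11 ?_)
    rw [hdiv]; exact v_mul_le_of_le_of_le_of_le_one h10 h01 ht1
  have hd1v : Valued.v (g 1 1 - g 1 0 * g 0 1 / g 0 0) = 1 := v_eq_one_of_v_sub_one_lt_one (hd1.trans_lt hc1)
  have hd10 : g 1 1 - g 1 0 * g 0 1 / g 0 0 ≠ 0 := fun h => by rw [h, map_zero] at hd1v; exact zero_ne_one hd1v
  have hdiv1 : ∀ x : K, Valued.v (x / (g 1 1 - g 1 0 * g 0 1 / g 0 0)) = Valued.v x := fun x => by rw [map_div₀, hd1v, div_one]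
  have hD' : g 0 0 * g 1 1 - g 1 0 * g 0 1 ≠ 0 := by
    intro h; apply hd10
    have : g 1 1 - g 1 0 * g 0 1 / g 0 0 = (g 0 0 * g 1 1 - g 1 0 * g 0 1) / g 0 0 := by field_simp
    rw [this, h, zero_div]
  have hD'' : g 0 0 * g 1 1 - g 0 1 * g 1 0 ≠ 0 := by rwa [mul_comm (g 0 1)]
  -- the off-diagonal entries of `L` and `U`
  have hl10 : Valued.v (g 1 0 / g 0 0) ≤ Valued.v c := by rw [hdiv]; exact h10
  have hl20 : Valued.v (g 2 0 / g 0 0) ≤ Valued.v c := by rw [hdiv]; exact h20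
  have hu01 : Valued.v (g 0 1 / g 0 0) ≤ Valued.v c := by rw [hdiv]; exact h01
  have hu02 : Valued.v (g 0 2 / g 0 0) ≤ Valued.v c := by rw [hdiv]; exact h02
  have hl21 : Valued.v ((g 2 1 - g 2 0 * g 0 1 / g 0 0) / (g 1 1 - g 1 0 * g 0 1 / g 0 0)) ≤ Valued.v c := by
    rw [hdiv1]; refine (Valuation.map_sub _ _ _).trans (max_le h21 ?_); rw [hdiv]; exact v_mul_le_of_le_of_le_of_le_one h20 h01 ht1
  have hu12 : Valued.v ((g 1 2 - g 1 0 * g 0 2 / g 0 0) / (g 1 1 - g 1 0 * g 0 1 / g 0 0)) ≤ Valued.v c := by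
    rw [hdiv1]; refine (Valuation.map_sub _ _ _).trans (max_le h12 ?_); rw [hdiv]; exact v_mul_le_of_le_of_le_of_le_one h10 h02 ht1
  -- the third pivot
  have hd2 : Valued.v (g 2 2 - g 2 0 * g 0 2 / g 0 0 -
      (g 2 1 - g 2 0 * g 0 1 / g 0 0) / (g 1 1 - g 1 0 * g 0 1 / g 0 0) * (g 1 1 - g 1 0 * g 0 1 / g 0 0) *
        ((g 1 2 - g 1 0 * g 0 2 / g 0 0) / (g 1 1 - g 1 0 * g 0 1 / g 0 0)) - 1) ≤ Valued.v c := by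
    have e : g 2 2 - g 2 0 * g 0 2 / g 0 0 -
        (g 2 1 - g 2 0 * g 0 1 / g 0 0) / (g 1 1 - g 1 0 * g 0 1 / g 0 0) * (g 1 1 - g 1 0 * g 0 1 / g 0 0) *
          ((g 1 2 - g 1 0 * g 0 2 / g 0 0) / (g 1 1 - g 1 0 * g 0 1 / g 0 0)) - 1 =
        (g 2 2 - 1) - g 2 0 * g 0 2 / g 0 0 -
        (g 2 1 - g 2 0 * g 0 1 / g 0 0) / (g 1 1 - g 1 0 * g 0 1 / g 0 0) * (g 1 1 - g 1 0 * g 0 1 / g 0 0) *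
          ((g 1 2 - g 1 0 * g 0 2 / g 0 0) / (g 1 1 - g 1 0 * g 0 1 / g 0 0)) := by ring
    rw [e]
    refine (Valuation.map_sub _ _ _).trans (max_le ((Valuation.map_sub _ _ _).trans (max_le h22 ?_)) ?_)
    · rw [hdiv]; exact v_mul_le_of_le_of_le_of_le_one h20 h02 ht1
    · rw [map_mul, map_mul, hd1v, mul_one]
      calc Valued.v ((g 2 1 - g 2 0 * g 0 1 / g 0 0) / (g 1 1 - g 1 0 * g 0 1 / g 0 0)) *
            Valued.v ((g 1 2 - g 1 0 * g 0 2 / g 0 0) / (g 1 1 - g 1 0 * g 0 1 / g 0 0)) ≤ Valued.v c * 1 := mul_le_mul' hl21 (hu12.trans ht1)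
        _ = Valued.v c := mul_one _
  refine ⟨!![1, 0, 0; g 1 0 / g 0 0, 1, 0; g 2 0 / g 0 0, (g 2 1 - g 2 0 * g 0 1 / g 0 0) / (g 1 1 - g 1 0 * g 0 1 / g 0 0), 1],
    !![g 0 0, 0, 0; 0, g 1 1 - g 1 0 * g 0 1 / g 0 0, 0; 0, 0,
      g 2 2 - g 2 0 * g 0 2 / g 0 0 -
        (g 2 1 - g 2 0 * g 0 1 / g 0 0) / (g 1 1 - g 1 0 * g 0 1 / g 0 0) * (g 1 1 - g 1 0 * g 0 1 / g 0 0) *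
          ((g 1 2 - g 1 0 * g 0 2 / g 0 0) / (g 1 1 - g 1 0 * g 0 1 / g 0 0))],
    !![1, g 0 1 / g 0 0, g 0 2 / g 0 0; 0, 1, (g 1 2 - g 1 0 * g 0 2 / g 0 0) / (g 1 1 - g 1 0 * g 0 1 / g 0 0); 0, 0, 1],
    ?_, ?_, ?_, ?_, ?_, ?_, ?_, ?_, ?_⟩
  · -- `g = L·D·U`
    ext i j
    fin_cases i <;> fin_cases j <;> simp [Matrix.mul_apply, Fin.sum_univ_three] <;> field_simp <;> ring
  · intro i j hij
    fin_cases i <;> fin_cases j <;> first | rfl | exact absurd hij (by decide)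
  · intro i; fin_cases i <;> rfl
  · intro i j hij
    fin_cases i <;> fin_cases j <;> first | rfl | exact absurd rfl hij
  · intro i j hij
    fin_cases i <;> fin_cases j <;> first | rfl | exact absurd hij (by decide)
  · intro i; fin_cases i <;> rfl
  · refine forall_v_apply_le_three ?_ ?_ ?_ ?_ ?_ ?_ ?_ ?_ ?_ <;> simp [-map_div₀] <;> first | exact zero_le | assumption
  · refine forall_v_apply_le_three ?_ ?_ ?_ ?_ ?_ ?_ ?_ ?_ ?_ <;> simp [-map_div₀] <;> first | exact zero_le | assumption
  · refine forall_v_apply_le_three ?_ ?_ ?_ ?_ ?_ ?_ ?_ ?_ ?_ <;> simp [-map_div₀] <;> first | exact zero_le | assumption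

/-! ## §4 Weighted Gauss at `N = 3` -/

/-- **WEIGHTED GAUSS AT `N = 3`**: if `|(g − 1)_{ij}|·|d_j| ≤ |c|·|d_i|` for all `i, j` (`|c| < 1`, `d_i ≠ 0`; i.e. `(g − 1)·latt (diagonal d) ⊆ c·latt (diagonal d)`, §1),
then `g = L·D·U` with `L` lower unitriangular, `D` diagonal, `U` upper unitriangular, EACH with the same weighted bound (conjugate §3 by `diagonal d`).
[cite: SchneiderStuhler1997, Ch. I §2 Prop. I.2.7] [cite: BruhatTits1972, §10] -/
theorem exists_weighted_ldu_three {c : K} (hc1 : Valued.v c < 1) {d : Fin 3 → K} (hd : ∀ i, d i ≠ 0) (g : Matrix (Fin 3) (Fin 3) K)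
    (hg : ∀ i j, Valued.v ((g - 1) i j) * Valued.v (d j) ≤ Valued.v c * Valued.v (d i)) :
    ∃ L D U : Matrix (Fin 3) (Fin 3) K, g = L * D * U ∧
      L.BlockTriangular OrderDual.toDual ∧ (∀ i, L i i = 1) ∧ (∀ i j, i ≠ j → D i j = 0) ∧ U.BlockTriangular id ∧ (∀ i, U i i = 1) ∧
      (∀ i j, Valued.v ((L - 1) i j) * Valued.v (d j) ≤ Valued.v c * Valued.v (d i)) ∧
      (∀ i j, Valued.v ((D - 1) i j) * Valued.v (d j) ≤ Valued.v c * Valued.v (d i)) ∧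
      (∀ i j, Valued.v ((U - 1) i j) * Valued.v (d j) ≤ Valued.v c * Valued.v (d i)) := by
  -- the plain conjugate `g′ = (d_i⁻¹ g_{ij} d_j)`
  have hg' : ∀ i j, Valued.v (((Matrix.of fun i' j' => (d i')⁻¹ * g i' j' * d j') - 1) i j) ≤ Valued.v c := by
    intro i j
    rw [of_conjDiagInv_sub_one hd]
    exact (weighted_iff_plain_conjDiagInv hd c (g - 1) i j).1 (hg i j)
  obtain ⟨L', D', U', hprod, hL', hL'1, hD', hU', hU'1, hbL', hbD', hbU'⟩ := exists_plain_ldu_three hc1 _ hg'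
  refine ⟨Matrix.of fun i j => d i * L' i j * (d j)⁻¹, Matrix.of fun i j => d i * D' i j * (d j)⁻¹, Matrix.of fun i j => d i * U' i j * (d j)⁻¹,
    ?_, ?_, ?_, ?_, ?_, ?_, ?_, ?_, ?_⟩
  · rw [of_conjDiag_mul hd, of_conjDiag_mul hd, ← hprod, of_conjDiag_conjDiagInv hd]
  · intro i j hij; rw [Matrix.of_apply, hL' hij, mul_zero, zero_mul]
  · intro i; rw [Matrix.of_apply, hL'1 i, mul_one, mul_inv_cancel₀ (hd i)]
  · intro i j hij; rw [Matrix.of_apply, hD' i j hij, mul_zero, zero_mul]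
  · intro i j hij; rw [Matrix.of_apply, hU' hij, mul_zero, zero_mul]
  · intro i; rw [Matrix.of_apply, hU'1 i, mul_one, mul_inv_cancel₀ (hd i)]
  · intro i j; rw [of_conjDiag_sub_one hd, weighted_of_conjDiag_iff hd]; exact hbL' i j
  · intro i j; rw [of_conjDiag_sub_one hd, weighted_of_conjDiag_iff hd]; exact hbD' i j
  · intro i j; rw [of_conjDiag_sub_one hd, weighted_of_conjDiag_iff hd]; exact hbU' i j

/-! ## §5 Monotone transfer of the weighted bound between diagonal lattices -/

/-- **LOWER TRANSFER**: a lower triangular `A` (`A_{ij} = 0` for `i < j`) with the weighted bound for `(d, c)` has it for `(d′, c)` whenever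
`|d′_j|·|d_i| ≤ |d_j|·|d′_i|` for all `j ≤ i` (the exponent difference `E′ − E` is non-increasing in the index).  Along the standard apartment of the `U(3)` tree this moves
the lower factor FORWARD (`A(j) → A(k)`, `k ≥ j`). [cite: SchneiderStuhler1997, Ch. I Prop. I.3.1 p. 118] -/
theorem weighted_transfer_lower {A : Matrix (Fin N) (Fin N) K} (hA : A.BlockTriangular OrderDual.toDual) {c : K} {d d' : Fin N → K} (hd : ∀ i, d i ≠ 0)
    (hw : ∀ i j, Valued.v (A i j) * Valued.v (d j) ≤ Valued.v c * Valued.v (d i))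
    (hmono : ∀ i j, j ≤ i → Valued.v (d' j) * Valued.v (d i) ≤ Valued.v (d j) * Valued.v (d' i)) :
    ∀ i j, Valued.v (A i j) * Valued.v (d' j) ≤ Valued.v c * Valued.v (d' i) := by
  intro i j
  rcases lt_or_ge i j with hij | hji
  · rw [hA (OrderDual.toDual_lt_toDual.2 hij), map_zero, zero_mul]; exact zero_le
  · have hpos : 0 < Valued.v (d j) * Valued.v (d i) :=
      mul_pos (zero_lt_iff.2 ((Valuation.ne_zero_iff _).2 (hd j))) (zero_lt_iff.2 ((Valuation.ne_zero_iff _).2 (hd i)))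
    have h1 := mul_le_mul' (hw i j) (hmono i j hji)
    refine le_of_mul_le_mul_right ?_ hpos
    calc Valued.v (A i j) * Valued.v (d' j) * (Valued.v (d j) * Valued.v (d i))
        = Valued.v (A i j) * Valued.v (d j) * (Valued.v (d' j) * Valued.v (d i)) := by ac_rfl
      _ ≤ Valued.v c * Valued.v (d i) * (Valued.v (d j) * Valued.v (d' i)) := h1
      _ = Valued.v c * Valued.v (d' i) * (Valued.v (d j) * Valued.v (d i)) := by ac_rfl

/-- **UPPER TRANSFER**: an upper triangular `A` (`A_{ij} = 0` for `j < i`) with the weighted bound for `(d, c)` has it for `(d′, c)` whenever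
`|d′_j|·|d_i| ≤ |d_j|·|d′_i|` for all `i ≤ j` (the exponent difference `E′ − E` is non-decreasing) — the upper factor moves BACKWARD along the apartment.
[cite: SchneiderStuhler1997, Ch. I Prop. I.3.1 p. 118] -/
theorem weighted_transfer_upper {A : Matrix (Fin N) (Fin N) K} (hA : A.BlockTriangular id) {c : K} {d d' : Fin N → K} (hd : ∀ i, d i ≠ 0)
    (hw : ∀ i j, Valued.v (A i j) * Valued.v (d j) ≤ Valued.v c * Valued.v (d i))
    (hmono : ∀ i j, i ≤ j → Valued.v (d' j) * Valued.v (d i) ≤ Valued.v (d j) * Valued.v (d' i)) :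
    ∀ i j, Valued.v (A i j) * Valued.v (d' j) ≤ Valued.v c * Valued.v (d' i) := by
  intro i j
  rcases lt_or_ge j i with hji | hij
  · rw [hA hji, map_zero, zero_mul]; exact zero_le
  · have hpos : 0 < Valued.v (d j) * Valued.v (d i) :=
      mul_pos (zero_lt_iff.2 ((Valuation.ne_zero_iff _).2 (hd j))) (zero_lt_iff.2 ((Valuation.ne_zero_iff _).2 (hd i)))
    have h1 := mul_le_mul' (hw i j) (hmono i j hij)
    refine le_of_mul_le_mul_right ?_ hpos
    calc Valued.v (A i j) * Valued.v (d' j) * (Valued.v (d j) * Valued.v (d i))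
        = Valued.v (A i j) * Valued.v (d j) * (Valued.v (d' j) * Valued.v (d i)) := by ac_rfl
      _ ≤ Valued.v c * Valued.v (d i) * (Valued.v (d j) * Valued.v (d' i)) := h1
      _ = Valued.v c * Valued.v (d' i) * (Valued.v (d j) * Valued.v (d i)) := by ac_rfl

/-- **DIAGONAL TRANSFER**: a diagonal `A` with the weighted bound for `(d, c)` (`d_i ≠ 0`) has it for EVERY `d′` — a diagonal element at level `c` has level `c` on every
diagonal lattice of its frame. [cite: SchneiderStuhler1997, Ch. I Prop. I.3.1 p. 118] [cite: BruhatTits1972, §10] -/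
theorem weighted_transfer_diagonal {A : Matrix (Fin N) (Fin N) K} (hA : ∀ i j, i ≠ j → A i j = 0) {c : K} {d : Fin N → K} (hd : ∀ i, d i ≠ 0)
    (hw : ∀ i j, Valued.v (A i j) * Valued.v (d j) ≤ Valued.v c * Valued.v (d i)) (d' : Fin N → K) :
    ∀ i j, Valued.v (A i j) * Valued.v (d' j) ≤ Valued.v c * Valued.v (d' i) := by
  intro i j
  by_cases hij : i = j
  · subst hij
    have hpos : 0 < Valued.v (d i) := zero_lt_iff.2 ((Valuation.ne_zero_iff _).2 (hd i))
    exact mul_le_mul_left (le_of_mul_le_mul_right (hw i i) hpos) _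
  · rw [hA i j hij, map_zero, zero_mul]; exact zero_le

/-- The plain bound on the DIAGONAL entries from the weighted one (`d_i ≠ 0`). [cite: Serre1980Trees, Ch. II §1.2] -/
theorem v_apply_diag_le_of_weighted {A : Matrix (Fin N) (Fin N) K} {c : K} {d : Fin N → K} (hd : ∀ i, d i ≠ 0)
    (hw : ∀ i j, Valued.v (A i j) * Valued.v (d j) ≤ Valued.v c * Valued.v (d i)) (i : Fin N) : Valued.v (A i i) ≤ Valued.v c :=
  le_of_mul_le_mul_right (hw i i) (zero_lt_iff.2 ((Valuation.ne_zero_iff _).2 (hd i)))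

end Literature.NumberTheory.Automorphic.UnitaryLatticeTree

end
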